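import Mathlib
import Summits.MatrixMultiplication.MatrixMultiplication.Theses.SnSubsetDichotomy
import Summits.MatrixMultiplication.MatrixMultiplication.Theorems.SnSubsetDichotomyPolynomialSlackStubSplit

/-!
# `SnSubsetDichotomy.JuntaBranch` — source atoms: the pigeonhole lower bound and hygiene lemmas

Helper lemmas for crux `stmt-MatrixMultiplication-8304` (`JuntaBranch`).  For `X ⊆ S_n`, an
injective target tuple `L : Fin t → Fin n` and a source tuple `J`, the ATOM of `X` at `(J → L)` is
`X_J := {σ ∈ X | σ ∘ J = L}`; the crux measures it by `R_X(J→L) := |X_J|·n^{(t)}/|X|`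
(`n^{(t)} = n.descFactorial t`), "super-neutral" meaning `R_X > n^{(1/2+ε)t}`.

* `exists_heavy_source_atom` (registered sub-goal) — the atoms of `X` at a fixed target `L` over the
  `n^{(t)}` injective sources partition `X` (the source of `σ` is `σ⁻¹ ∘ L`), so some injective `J`
  has `|X| ≤ n^{(t)}·|X_J|`, i.e. `R_X(J→L) ≥ 1`.  This is the ONLY lower bound on partner atoms that
  counting supplies; the crux's cashing mechanism needs `R_T·R_U ≥ e^{c+1} n^{(1−ε)t}` next to a
  super-neutral block of `S`, and the gap `n^{(1−ε)t}` is the crux's open content (see the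
  docstring of `Theorems.JuntaBranch.juntaBranch_of_nearMaxImproves`).
* `nonempty_of_large` / `sqrt_factorial_le_card_of_large` — the volume floor
  `(n!)^{3/2}e^{−c√n} ≤ |S||T||U|` of the crux forces all three sets non-empty and, with the packing
  bound `|T||U| ≤ n!` (tree lemmas `PolynomialSlack.injOn_quot_second`,
  `PolynomialSlack.card_mul_card_le_factorial_of_injOn`), `√(n!)·e^{−c√n} ≤ |S|`.
* `card_pos_of_bump` / `eps_lt_half_of_bump` — a super-neutral block forces `X ≠ ∅` and `ε < 1/2`
  (since `|X_J|·n^{(t)} ≤ |X|·n^t`), the WLOG range recorded by the crux's disprover.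
-/

set_option linter.dupNamespace false

open Literature.Combinatorics.Additive
open Summit.MatrixMultiplication.MatrixMultiplication.Theses.SnSubsetDichotomy
open scoped Classical

namespace Summit.MatrixMultiplication.MatrixMultiplication.Theorems.JuntaBranch

/-- **Heavy source atom (pigeonhole).**  For `X ⊆ S_n` and an injective target tuple
`L : Fin t → Fin n` there is an injective source tuple `J` whose atom carries at least the average:
`|X| ≤ n^{(t)} · |{σ ∈ X | σ ∘ J = L}|`.  (The map `σ ↦ σ⁻¹ ∘ L` sends `X` into the `n^{(t)}`
injective tuples, and its fibre over `J` is the atom at `(J → L)`.)  Registered sub-goal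
`exists_heavy_source_atom` of the crux. [folklore] -/
theorem exists_heavy_source_atom :
    ∀ (n t : ℕ) (X : Finset (Equiv.Perm (Fin n))) (L : Fin t → Fin n), Function.Injective L →
      ∃ J : Fin t → Fin n, Function.Injective J ∧
        X.card ≤ n.descFactorial t * (X.filter (fun σ => ∀ k, σ (J k) = L k)).card := by
  intro n t X L hL
  -- the injective tuples, as a Finset of functions
  set B : Finset (Fin t → Fin n) := Finset.univ.filter (fun J => Function.Injective J) with hB
  have hBcard : B.card = n.descFactorial t := by
    have h1 : B = Finset.univ.map ⟨(fun e : Fin t ↪ Fin n => (e : Fin t → Fin n)),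
        DFunLike.coe_injective⟩ := by
      ext J
      simp only [hB, Finset.mem_filter, Finset.mem_univ, true_and, Finset.mem_map,
        Function.Embedding.coeFn_mk]
      constructor
      · intro hJ; exact ⟨⟨J, hJ⟩, rfl⟩
      · rintro ⟨e, rfl⟩; exact e.injective
    rw [h1, Finset.card_map, Finset.card_univ, Fintype.card_embedding_eq, Fintype.card_fin,
      Fintype.card_fin]
  -- the source map
  set f : Equiv.Perm (Fin n) → (Fin t → Fin n) := fun σ k => σ.symm (L k) with hf
  have hmaps : ∀ σ ∈ X, f σ ∈ B := by
    intro σ _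
    simp only [hB, Finset.mem_filter, Finset.mem_univ, true_and, hf]
    exact σ.symm.injective.comp hL
  -- the fibre over `J` is the atom at `(J → L)`
  have hfib : ∀ J, X.filter (fun σ => f σ = J) = X.filter (fun σ => ∀ k, σ (J k) = L k) := by
    intro J
    apply Finset.filter_congr
    intro σ _
    simp only [hf, funext_iff]
    exact forall_congr' (fun k => by rw [Equiv.symm_apply_eq, eq_comm])
  -- pigeonhole: |X| = Σ_J |fibre J| ≤ |B| · max
  rcases X.eq_empty_or_nonempty with rfl | hX
  · exact ⟨L, hL, by simp⟩
  have hBne : B.Nonempty := by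
    obtain ⟨σ, hσ⟩ := hX
    exact ⟨f σ, hmaps σ hσ⟩
  obtain ⟨J, hJB, hJmax⟩ :=
    B.exists_max_image (fun J => (X.filter (fun σ => f σ = J)).card) hBne
  refine ⟨J, (Finset.mem_filter.mp hJB).2, ?_⟩
  rw [← hfib J, ← hBcard]
  calc X.card = ∑ K ∈ B, (X.filter (fun σ => f σ = K)).card :=
        Finset.card_eq_sum_card_fiberwise hmaps
    _ ≤ ∑ _K ∈ B, (X.filter (fun σ => f σ = J)).card := Finset.sum_le_sum (fun K hK => hJmax K hK)
    _ = B.card * (X.filter (fun σ => f σ = J)).card := by rw [Finset.sum_const, smul_eq_mul]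

/-- The volume floor of the crux (`Large`) forces all three sets to be non-empty. [folklore] -/
theorem nonempty_of_large {n : ℕ} {c : ℝ} {S T U : Finset (Equiv.Perm (Fin n))}
    (hL : (n.factorial : ℝ) ^ ((3 : ℝ) / 2) * Real.exp (-(c * Real.sqrt (n : ℝ))) ≤
      ((S.card * T.card * U.card : ℕ) : ℝ)) :
    S.Nonempty ∧ T.Nonempty ∧ U.Nonempty := by
  have hpos : (0 : ℝ) < ((S.card * T.card * U.card : ℕ) : ℝ) := lt_of_lt_of_le (by positivity) hL
  have hpos' : 0 < S.card * T.card * U.card := by exact_mod_cast hpos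
  refine ⟨Finset.card_pos.mp ?_, Finset.card_pos.mp ?_, Finset.card_pos.mp ?_⟩
  · exact Nat.pos_of_ne_zero (fun h => by simp [h] at hpos')
  · exact Nat.pos_of_ne_zero (fun h => by simp [h] at hpos')
  · exact Nat.pos_of_ne_zero (fun h => by simp [h] at hpos')

/-- **Member floor.**  In a TPP triple meeting the crux's volume floor, the first set has at least
`√(n!)·e^{−c√n}` elements: `(n!)^{3/2}e^{−c√n} ≤ |S||T||U| ≤ |S|·n!` by the packing bound
`|T||U| ≤ n!` (injectivity of `(τ, υ) ↦ τ⁻¹υ` on `T × U`).  By `TripleProductProperty.rotate` the same holds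
for `T` and `U`. [folklore] -/
theorem sqrt_factorial_le_card_of_large {n : ℕ} {c : ℝ} {S T U : Finset (Equiv.Perm (Fin n))}
    (h : TripleProductProperty S T U)
    (hL : (n.factorial : ℝ) ^ ((3 : ℝ) / 2) * Real.exp (-(c * Real.sqrt (n : ℝ))) ≤
      ((S.card * T.card * U.card : ℕ) : ℝ)) :
    Real.sqrt (n.factorial : ℝ) * Real.exp (-(c * Real.sqrt (n : ℝ))) ≤ (S.card : ℝ) := by
  obtain ⟨hS, -, -⟩ := nonempty_of_large hL
  -- packing `|T||U| ≤ n!` (the quotient map `(τ, υ) ↦ τ⁻¹υ` is injective on `T × U`)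
  have hpack : T.card * U.card ≤ n.factorial :=
    PolynomialSlack.card_mul_card_le_factorial_of_injOn (PolynomialSlack.injOn_quot_second h hS)
  have hF : (0 : ℝ) < (n.factorial : ℝ) := by exact_mod_cast n.factorial_pos
  have hvol : ((S.card * T.card * U.card : ℕ) : ℝ) ≤ (S.card : ℝ) * (n.factorial : ℝ) := by
    have : S.card * T.card * U.card ≤ S.card * n.factorial := by
      rw [mul_assoc]; exact Nat.mul_le_mul_left _ hpack
    exact_mod_cast this
  have hsplit : (n.factorial : ℝ) ^ ((3 : ℝ) / 2) = Real.sqrt (n.factorial : ℝ) * (n.factorial : ℝ) := by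
    rw [show (3 : ℝ) / 2 = 1 / 2 + 1 by norm_num, Real.rpow_add hF, Real.rpow_one,
      Real.sqrt_eq_rpow]
  rw [hsplit] at hL
  have key : Real.sqrt (n.factorial : ℝ) * Real.exp (-(c * Real.sqrt (n : ℝ))) * (n.factorial : ℝ)
      ≤ (S.card : ℝ) * (n.factorial : ℝ) := by
    calc _ = Real.sqrt (n.factorial : ℝ) * (n.factorial : ℝ) * Real.exp (-(c * Real.sqrt (n : ℝ))) := by
          ring
      _ ≤ _ := hL.trans hvol
  exact le_of_mul_le_mul_right key hF

/-- A super-neutral block forces the bumpy set to be non-empty. [folklore] -/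
theorem card_pos_of_bump {n : ℕ} {ε : ℝ} {t : ℕ} {I L : Fin t → Fin n}
    {X : Finset (Equiv.Perm (Fin n))}
    (hb : (n : ℝ) ^ ((1 / 2 + ε) * t) * (X.card : ℝ) <
      ((X.filter (fun σ => ∀ k, σ (I k) = L k)).card : ℝ) * (n.descFactorial t : ℝ)) :
    0 < X.card := by
  by_contra h0
  push Not at h0
  have hX : X.card = 0 := Nat.le_zero.mp h0
  have hf : (X.filter (fun σ => ∀ k, σ (I k) = L k)).card = 0 := by
    rw [← Nat.le_zero, ← hX]; exact Finset.card_le_card (Finset.filter_subset _ _)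
  rw [hX, hf] at hb
  simp at hb

/-- **Super-neutrality needs `ε < 1/2`** (the crux is vacuous for `ε ≥ 1/2`, as its disprover
recorded): `n^{(1/2+ε)t}|X| < |X_I|·n^{(t)} ≤ |X|·n^t` with `X ≠ ∅` gives `n^{(1/2+ε)t} < n^t`,
whence `n ≥ 2`, `t ≥ 1` and `(1/2+ε)t < t`. [folklore] -/
theorem eps_lt_half_of_bump {n : ℕ} {ε : ℝ} {t : ℕ} {I L : Fin t → Fin n}
    {X : Finset (Equiv.Perm (Fin n))}
    (hb : (n : ℝ) ^ ((1 / 2 + ε) * t) * (X.card : ℝ) <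
      ((X.filter (fun σ => ∀ k, σ (I k) = L k)).card : ℝ) * (n.descFactorial t : ℝ)) :
    ε < 1 / 2 := by
  have hXpos : (0 : ℝ) < X.card := by exact_mod_cast card_pos_of_bump hb
  have hfil : ((X.filter (fun σ => ∀ k, σ (I k) = L k)).card : ℝ) ≤ X.card := by
    exact_mod_cast Finset.card_le_card (Finset.filter_subset _ _)
  have hdesc : (n.descFactorial t : ℝ) ≤ (n : ℝ) ^ (t : ℝ) := by
    rw [Real.rpow_natCast]; exact_mod_cast Nat.descFactorial_le_pow n t
  have hn0 : (0 : ℝ) ≤ n := Nat.cast_nonneg n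
  -- n^{(1/2+ε)t} < n^t
  have hlt : (n : ℝ) ^ ((1 / 2 + ε) * t) < (n : ℝ) ^ (t : ℝ) := by
    have h1 : (n : ℝ) ^ ((1 / 2 + ε) * t) * (X.card : ℝ) < (n : ℝ) ^ (t : ℝ) * (X.card : ℝ) :=
      calc _ < ((X.filter (fun σ => ∀ k, σ (I k) = L k)).card : ℝ) * (n.descFactorial t : ℝ) := hb
        _ ≤ (X.card : ℝ) * (n : ℝ) ^ (t : ℝ) :=
            mul_le_mul hfil hdesc (Nat.cast_nonneg _) hXpos.le
        _ = (n : ℝ) ^ (t : ℝ) * (X.card : ℝ) := by ring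
    exact lt_of_mul_lt_mul_right h1 hXpos.le
  -- hence n > 1 and the exponents compare
  have hn1 : (1 : ℝ) < n := by
    by_contra hle
    push Not at hle
    rcases hle.lt_or_eq with hlt1 | heq1
    · -- n = 0
      have hn' : (n : ℝ) = 0 := by
        have : n < 1 := by exact_mod_cast hlt1
        simp [Nat.lt_one_iff.mp this]
      rw [hn'] at hlt
      rcases Nat.eq_zero_or_pos t with rfl | ht
      · simp at hlt
      · have ht' : (t : ℝ) ≠ 0 := by exact_mod_cast ht.ne'
        rw [Real.zero_rpow ht'] at hlt
        exact absurd hlt (not_lt.mpr (Real.rpow_nonneg le_rfl _))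
    · rw [heq1] at hlt
      simp at hlt
  have hexp : (1 / 2 + ε) * t < (t : ℝ) := (Real.rpow_lt_rpow_left_iff hn1).mp hlt
  have ht0 : (0 : ℝ) < t := by
    by_contra hle
    push Not at hle
    have ht' : (t : ℝ) = 0 := le_antisymm hle (Nat.cast_nonneg t)
    rw [ht'] at hexp
    simp at hexp
  nlinarith

end Summit.MatrixMultiplication.MatrixMultiplication.Theorems.JuntaBranch
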